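import Summits.Ventures.YMGap.RobustBall.ZTwoLayerGraph
import Summits.Ventures.YMGap.RobustBall.ZNFluxGenPeeling
import Summits.Ventures.YMGap.RobustBall.CentreBlindAreaLaw
import Summits.Ventures.YMGap.RobustBall.CentreSchur
import Summits.Ventures.YMGap.RobustBall.CentreTubeTierOne
import Summits.Ventures.YMGap.RobustBall.StringTensionCentreBlind
import Literature.Barriers.HubbardSuperconductivity.WeakCouplingCeiling
import Literature.ComputerArithmetic.DeDinechinLauterMullerTorres2013.TinyArguments
import HarnessLib

/-!
# RobustBall/CentreBlindStarWindow — THE STAR WINDOW: `AreaLawCentreBlind 2 d β` for `SU(2)` whenever `2(d−1)(2d−3)·tanh²(β_W) < 1`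
# (`d = 4`: `30 tanh² β_W < 1`, `β_W < 0.1846…`; gen 7's Dobrushin window was `6 β_W < 1`)

HONEST FRAMING: venture file of the cell `pub-ymgap` (QuantumFields programme), track Y2 ROBUST-BALL / DS seat ds-4 (g9).  WHAT THIS IS: a
strong-coupling LATTICE theorem — Wilson's area law `|⟨W_{R×T}⟩_{β,W,L}| ≤ C^{2(R+T)} e^{−cRT}` with ONE pair `(C, c)` on every torus, for `SU(2)` and
EVERY LINKWISE CENTRE-BLIND perturbation `W` (any size, any range: adjoint / mixed fundamental–adjoint couplings of any strength, …), i.e. gen 7's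
countersigned currency `AreaLawCentreBlind 2 d β` (ROBUST-BALL-STATEMENT §6(c), T13C), now for `2(d−1)(2(d−1)−1) tanh²(2|β|) < 1` instead of
`2(d−1)·2|β| < 1` (`β = β_W/2` the tree coupling): the SECOND RUNG of the `β`-ladder for the centre-blind window.  MECHANISM: centre projection
(Fröhlich 1979 / Mack–Petkova 1979, gen 7) reduces the loop to the `ℤ₂` lattice gauge theory with `U`-dependent plaquette weights; transverse and
block conditioning (gen 8) reduce it to rung two-point functions of the `i`-LAYER system, which for `N = 2` IS an Ising model on the layer graph
(`(d−1)`-dimensional torus slices, degree `2(d−1)`, triangle-free for `L ≥ 4`) with couplings `|J| ≤ 2|β|` of either sign (`ZTwoLayerIsing`,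
`ZTwoLayerGraph`); Griffiths' comparison bounds them by the FERROMAGNET at `2|β|`, and the Simon–Lieb inequality with STARS (`IsingStarDecay`, on the
tree's random-current proof of the modified Simon inequality) gives the rate `(2(d−1)(2d−3) tanh²(2|β|))^{⌊T/2⌋}` per rung — beyond the single-site
(Dobrushin) radius.  HONEST LABEL: `SU(2)` only (the `ℤ₂` layer is an Ising model; `N ≥ 3` layers are clock models, not treated); centre-blind class only
(NO tube: twist defects are signed multi-body terms outside Griffiths' comparison); window `d = 4`: `tanh β_W < 1/√30`, i.e. `β_W < 0.18463`
(cell `β_W = 9/50` via `tanh x ≤ x`), vs `1/6` before and vs the `ℤ₂`-gauge transition `≈ 0.44` where the class genuinely deconfines; the rate is a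
door artefact; nothing continuum / spectral / Clay.  Next rungs = larger Simon–Lieb sets `B_r` with COMPUTED certificates for `⟨σ_aσ_x⟩_{B_r}`.

References AS PRINTED: J. Fröhlich, Phys. Lett. B 83 (1979) 195; G. Mack, V. B. Petkova, Ann. Phys. 123 (1979) 442; B. Simon, Comm. Math. Phys. 77
(1980) 111; E. Lieb, Comm. Math. Phys. 77 (1980) 127; H. Duminil-Copin, V. Tassion, Comm. Math. Phys. 343 (2016) 725, Lemma 2.7; R. Griffiths,
J. Math. Phys. 8 (1967) 478.
-/

noncomputable section

open Finset MeasureTheory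
open Literature.MathematicalPhysics.QuantumLattice (fundamentalRep)
open Literature.MathematicalPhysics.QuantumFieldTheory

namespace Summit.Ventures.YMGap.RobustBall

open ZN ZNFluxW ZTwo

variable {d L : ℕ} [NeZero L]

/-- The STAR RATE `φ₀ = 2(d−1)(2(d−1)−1) tanh²(2|β|)`. [folklore] -/
def layerStarRate (d : ℕ) (β : ℝ) : ℝ := (((2 * (d - 1) : ℕ) : ℝ)) * (((2 * (d - 1) : ℕ) : ℝ) - 1) * Real.tanh (2 * |β|) ^ 2

omit [NeZero L] in
/-- `0 ≤ φ₀` (for `d ≥ 1`; also for `d = 0` where it is `0`). [folklore] -/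
theorem layerStarRate_nonneg (d : ℕ) (β : ℝ) : 0 ≤ layerStarRate d β := by
  unfold layerStarRate
  refine mul_nonneg ?_ (sq_nonneg _)
  rcases Nat.eq_zero_or_pos (2 * (d - 1)) with h0 | hpos
  · rw [h0]; simp
  · have : (1 : ℝ) ≤ ((2 * (d - 1) : ℕ) : ℝ) := by exact_mod_cast hpos
    nlinarith

/-- **The induced `ℤ₂` Wilson loop (no twist defect) obeys the STAR-RATE bound** (`L ≥ 4`, `i ≠ j`, `2R, 2T ≤ L`):
`‖znLoopW‖ ≤ (φ₀^{⌊T/2⌋})^{#selIdx 1 R}`. [folklore] -/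
theorem norm_znLoopW_le_star (hL : 4 ≤ L) (β : ℝ) (gD : Fin 0 → (Plaquette d L → ZMod 2) → GaugeConfig d L (SUN 2) → ℝ)
    (U : GaugeConfig d L (SUN 2)) (x : Site d L) {i j : Fin d} (hij : i ≠ j) {R T : ℕ} (hR : 2 * R ≤ L) (hT : 2 * T ≤ L) :
    ‖znLoopW β gD U x i j R T‖ ≤ (layerStarRate d β ^ (T / 2)) ^ (selIdx 1 R).card := by
  classical
  unfold znLoopW
  refine norm_cavg_ψ_loopSum_le_of_bound (supp := suppS (fun _ : Fin 0 => (∅ : Finset (Plaquette d L)))) (g := gS β gD U)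
    ?_ hij (m := 1) ?_ (F := fun D => layerStarRate d β ^ (D / 2)) (fun H kT κ b t => ?_) x hR hT
  · rintro (p | t)
    · intro φ φ' h
      simp only [gS, Sum.elim_inl]
      rw [h p (by simp [suppS])]
    · exact Fin.elim0 t
  · rintro (p | t) y hy y' hy'
    · simp only [suppS, Sum.elim_inl, iLinks_singleton] at hy hy'
      rw [iDist_eq_zero_of_mem_iSites i p hy hy']; exact Nat.one_pos
    · exact Fin.elim0 t
  · exact norm_cavg_ψ_two_le_starRate_pow hL β gD U i j H kT κ b t

/-- **CENTRE PROJECTION + STAR RATE** (`SU(2)`, `L ≥ 4`): for EVERY twist-blind `W` and every non-wrapping `R × T` loop,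
`|⟨(1/2) tr U_{R×T}⟩_{β,W,L}| ≤ (φ₀^{⌊T/2⌋})^{#selIdx 1 R}`. [cite: Frohlich1979ZN, Eq. (7)–(9)] -/
theorem abs_wilsonLoop_le_star (hL : 4 ≤ L) {β : ℝ} (W : Perturbation d L 2) (hW : IsTwistBlind W) (x : Site d L) {i j : Fin d}
    (hij : i ≠ j) {R T : ℕ} (hR : 2 * R ≤ L) (hT : 2 * T ≤ L) :
    |W.expectation (fundamentalRep (Fin 2)) β (wilsonLoop (fundamentalRep (Fin 2)) x i j R T)| ≤
      (layerStarRate d β ^ (T / 2)) ^ (selIdx 1 R).card :=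
  abs_expectation_wilsonLoop_le_of_fluxDefect W (c := W.total) (gD := fun (_ : Fin 0) _ _ => (0 : ℝ))
    (fun k U => by rw [hW k U]; simp) β x i j R T fun U => norm_znLoopW_le_star hL β _ U x hij hR hT

/-- The area-law normal form of the star-rate bound: for `0 < c₀ ≤ 1`, `c = −log c₀ / 2`,
`(c₀^{⌊T/2⌋})^R ≤ (e^{c/2})^{2(R+T)} · e^{−c RT}`. [folklore] -/
theorem starShape {c₀ : ℝ} (hc0 : 0 < c₀) (hc1 : c₀ ≤ 1) (R T : ℕ) :
    (c₀ ^ (T / 2)) ^ R ≤ Real.exp (-Real.log c₀ / 2 / 2) ^ (2 * (R + T)) * Real.exp (-(-Real.log c₀ / 2) * ((R : ℝ) * T)) := by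
  set c := -Real.log c₀ / 2 with hc
  have hcnn : 0 ≤ c := div_nonneg (neg_nonneg.2 (Real.log_nonpos hc0.le hc1)) (by norm_num)
  have hlog : Real.log c₀ = -2 * c := by rw [hc]; ring
  rw [← Real.rpow_natCast c₀, ← Real.rpow_natCast, ← Real.rpow_mul hc0.le, Real.rpow_def_of_pos hc0, ← Real.exp_nat_mul,
    ← Real.exp_add]
  apply Real.exp_le_exp.2
  have h2n : ((T : ℝ) - 1) ≤ 2 * ((T / 2 : ℕ) : ℝ) := by
    have : T ≤ 2 * (T / 2) + 1 := by omega
    have : (T : ℝ) ≤ 2 * ((T / 2 : ℕ) : ℝ) + 1 := by exact_mod_cast this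
    linarith
  rw [hlog]
  push_cast
  have hR0 : (0 : ℝ) ≤ R := Nat.cast_nonneg R
  have hn0 : (0 : ℝ) ≤ ((T / 2 : ℕ) : ℝ) := Nat.cast_nonneg _
  nlinarith [mul_nonneg hcnn hR0, mul_nonneg (mul_nonneg hcnn hR0) hn0]

/-- **THE STAR WINDOW: `AreaLawCentreBlind 2 d β` whenever `φ₀ = 2(d−1)(2(d−1)−1) tanh²(2|β|) < 1`** — Wilson's area law with ONE `(C, c)` for
`SU(2)` plus EVERY linkwise centre-blind perturbation on every torus (`C = e^{c/2}`, `c = −log max(φ₀, 1/2)/2`). [cite: MackPetkova1979, §2] -/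
theorem su2_areaLawCentreBlind_star {β : ℝ} (hφ : layerStarRate d β < 1) : AreaLawCentreBlind 2 d β := by
  set c₀ := max (layerStarRate d β) (1 / 2) with hc₀
  have hc0 : 0 < c₀ := lt_max_of_lt_right (by norm_num)
  have hc1 : c₀ < 1 := max_lt hφ (by norm_num)
  have hφle : layerStarRate d β ≤ c₀ := le_max_left _ _
  set c := -Real.log c₀ / 2 with hc
  have hcpos : 0 < c := div_pos (neg_pos.2 (Real.log_neg hc0 hc1)) (by norm_num)
  set C := Real.exp (c / 2) with hC
  have hC1 : 1 ≤ C := Real.one_le_exp (by positivity)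
  refine ⟨C, c, hcpos, fun L _ W hW x i j R T hij hR1 hT1 hRL hTL => ?_⟩
  have hWt : IsTwistBlind W := hW.isTwistBlind
  by_cases hL : 4 ≤ L
  · refine (abs_wilsonLoop_le_star hL W hWt x hij hRL hTL).trans ?_
    -- monotonicity: `φ₀ ≤ c₀`, `#selIdx 1 R ≥ R`
    have h1 : (layerStarRate d β ^ (T / 2)) ^ (selIdx 1 R).card ≤ (c₀ ^ (T / 2)) ^ (selIdx 1 R).card :=
      pow_le_pow_left₀ (pow_nonneg (layerStarRate_nonneg d β) _) (pow_le_pow_left₀ (layerStarRate_nonneg d β) hφle _) _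
    have h2 : (c₀ ^ (T / 2)) ^ (selIdx 1 R).card ≤ (c₀ ^ (T / 2)) ^ R :=
      pow_le_pow_of_le_one (pow_nonneg hc0.le _) (pow_le_one₀ hc0.le hc1.le) (by simpa using le_mul_card_selIdx Nat.one_pos R)
    refine h1.trans (h2.trans ?_)
    have h3 := starShape hc0 hc1.le R T
    rw [← hc] at h3
    exact h3
  · -- small torus: `R = T = 1`, the loop is bounded by `1 ≤ C⁴ e^{−c}`
    have hR : R = 1 := by omega
    have hT : T = 1 := by omega
    subst hR; subst hT
    refine (abs_expectation_wilsonLoop_le_one W β x i j 1 1).trans ?_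
    rw [hC, ← Real.exp_nat_mul, ← Real.exp_add]
    exact Real.one_le_exp (by push_cast; nlinarith)

/-! ### Rows -/

/-- **SU(2), `d = 4`: `30 tanh²(β_W) < 1 ⇒ AreaLawCentreBlind 2 4 β`** (`β_W = 2|β|`; `tanh β_W < 1/√30`, `β_W < 0.18463…`; gen 7: `6 β_W < 1`).
[folklore] -/
theorem su2_areaLawCentreBlind_star_dim4 {β : ℝ} (h : 30 * Real.tanh (2 * |β|) ^ 2 < 1) : AreaLawCentreBlind 2 4 β :=
  su2_areaLawCentreBlind_star (d := 4) (by unfold layerStarRate; push_cast; linarith)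

/-- **SU(2), `d = 3`: `12 tanh²(β_W) < 1 ⇒ AreaLawCentreBlind 2 3 β`** (`tanh β_W < 1/√12`, `β_W < 0.2971…`; gen 7: `4 β_W < 1`). [folklore] -/
theorem su2_areaLawCentreBlind_star_dim3 {β : ℝ} (h : 12 * Real.tanh (2 * |β|) ^ 2 < 1) : AreaLawCentreBlind 2 3 β :=
  su2_areaLawCentreBlind_star (d := 3) (by unfold layerStarRate; push_cast; linarith)

/-- **CELL SU(2), `d = 4`, `β_W = 9/50 = 0.18`** (beyond the Dobrushin window `β_W < 1/6`): `AreaLawCentreBlind 2 4 (9/100)` (via `tanh x ≤ x`: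
`30 · 0.18² = 0.972 < 1`). [folklore] -/
theorem su2_areaLawCentreBlind_star_cell : AreaLawCentreBlind 2 4 (9 / 100) := by
  refine su2_areaLawCentreBlind_star_dim4 ?_
  have h1 : Real.tanh (2 * |(9 / 100 : ℝ)|) ≤ 9 / 50 := by
    rw [abs_of_pos (by norm_num)]
    exact (Literature.Barriers.HubbardSuperconductivity.tanh_le_self (by norm_num)).trans (by norm_num)
  have h0 : 0 ≤ Real.tanh (2 * |(9 / 100 : ℝ)|) := by
    rw [Real.tanh_eq_sinh_div_cosh]
    exact div_nonneg (Real.sinh_nonneg_iff.2 (by positivity)) (Real.cosh_pos _).le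
  nlinarith

/-- **Rung 2 contains rung 1** (`d = 4`): the Dobrushin window `6 β_W < 1` implies the star window (`tanh x ≤ x`, `30/36 < 1`). [folklore] -/
theorem su2_areaLawCentreBlind_star_of_dobrushin {β : ℝ} (h : 6 * (2 * |β|) < 1) : AreaLawCentreBlind 2 4 β := by
  refine su2_areaLawCentreBlind_star_dim4 ?_
  have h0 : 0 ≤ Real.tanh (2 * |β|) := by
    rw [Real.tanh_eq_sinh_div_cosh]
    exact div_nonneg (Real.sinh_nonneg_iff.2 (by positivity)) (Real.cosh_pos _).le
  have h1 : Real.tanh (2 * |β|) ≤ 2 * |β| := Literature.Barriers.HubbardSuperconductivity.tanh_le_self (by positivity)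
  have h2 : 2 * |β| < 1 / 6 := by linarith
  nlinarith

/-- **SHARPER CELL SU(2), `d = 4`, `β_W = 23/125 = 0.184`** (the star window ends at `β_W = artanh(1/√30) = 0.18463…`): `AreaLawCentreBlind 2 4 (23/250)`,
via the quintic enclosure `tanh x ≤ x − x³/3 + 2x⁵/15` (`30 · tanh²(0.184) ≤ 0.9932 < 1`). [folklore] -/
theorem su2_areaLawCentreBlind_star_cell_sharp : AreaLawCentreBlind 2 4 (23 / 250) := by
  refine su2_areaLawCentreBlind_star_dim4 ?_
  have hx : (2 * |(23 / 250 : ℝ)|) = 23 / 125 := by rw [abs_of_pos (by norm_num)]; norm_num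
  rw [hx]
  have h0 : 0 ≤ Real.tanh (23 / 125 : ℝ) := by
    rw [Real.tanh_eq_sinh_div_cosh]
    exact div_nonneg (Real.sinh_nonneg_iff.2 (by positivity)) (Real.cosh_pos _).le
  have hp : Real.tanh (23 / 125 : ℝ) ≤ 23 / 125 - (23 / 125 : ℝ) ^ 3 / 3 + 2 / 15 * (23 / 125 : ℝ) ^ 5 :=
    (Literature.ComputerArithmetic.DeDinechinLauterMullerTorres2013.tanh_quintic_bounds (by norm_num) (by norm_num)).2
  have ht2 : Real.tanh (23 / 125 : ℝ) ^ 2 ≤ (23 / 125 - (23 / 125 : ℝ) ^ 3 / 3 + 2 / 15 * (23 / 125 : ℝ) ^ 5) ^ 2 :=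
    pow_le_pow_left₀ h0 hp 2
  have hnum : 30 * (23 / 125 - (23 / 125 : ℝ) ^ 3 / 3 + 2 / 15 * (23 / 125 : ℝ) ^ 5) ^ 2 < 1 := by norm_num
  linarith

/-- **CELL SU(2), `d = 3`, `β_W = 7/25 = 0.28`** (beyond the Dobrushin window `β_W < 1/4`): `AreaLawCentreBlind 2 3 (7/50)` (`12 · 0.28² = 0.9408 < 1`).
[folklore] -/
theorem su2_areaLawCentreBlind_star_cell_dim3 : AreaLawCentreBlind 2 3 (7 / 50) := by
  refine su2_areaLawCentreBlind_star_dim3 ?_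
  have h1 : Real.tanh (2 * |(7 / 50 : ℝ)|) ≤ 7 / 25 := by
    rw [abs_of_pos (by norm_num)]
    exact (Literature.Barriers.HubbardSuperconductivity.tanh_le_self (by norm_num)).trans (by norm_num)
  have h0 : 0 ≤ Real.tanh (2 * |(7 / 50 : ℝ)|) := by
    rw [Real.tanh_eq_sinh_div_cosh]
    exact div_nonneg (Real.sinh_nonneg_iff.2 (by positivity)) (Real.cosh_pos _).le
  nlinarith

/-! ### Limit states in the star window -/

/-- **STRING TENSION IN THE STAR WINDOW** (`SU(2)`, `d ≥ 2`, `2(d−1)(2(d−1)−1) tanh²(2|β|) < 1`): ONE pair `(C, c)`, `c > 0`, such that every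
infinite-volume limit state of every eventually-centre-blind family obeys `Literature.MathematicalPhysics.QuantumLattice.HasAreaLawWith μ χ₂ C c`, `Literature.MathematicalPhysics.QuantumLattice.HasAreaLawState`, `σ ≥ c` WHENEVER its
string tension exists, and `Literature.MathematicalPhysics.QuantumLattice.IsConfining` given existence (gen 7's `stringTension_centreBlind` on the star window).  Existence of `σ` NOT asserted.
[folklore] -/
theorem su2_stringTension_centreBlind_star [NeZero d] (hd : 2 ≤ d) {β : ℝ} (hφ : layerStarRate d β < 1) :
    ∃ C c : ℝ, 0 < c ∧ ∀ 𝓦 : PerturbationFamily d 2,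
      (∀ᶠ L : ℕ in Filter.atTop, IsCentreBlind (𝓦 L)) →
        ∀ μ ∈ perturbedLimitPoints β 𝓦,
          Literature.MathematicalPhysics.QuantumLattice.HasAreaLawWith μ (fun g => Literature.MathematicalPhysics.QuantumLattice.normalisedCharacter 2 (fundamentalRep (Fin 2) g)) C c ∧
          Literature.MathematicalPhysics.QuantumLattice.HasAreaLawState μ (fun g => Literature.MathematicalPhysics.QuantumLattice.normalisedCharacter 2 (fundamentalRep (Fin 2) g)) ∧
          (∀ σ : ℝ, Literature.MathematicalPhysics.QuantumLattice.HasStringTension μ (fun g => Literature.MathematicalPhysics.QuantumLattice.normalisedCharacter 2 (fundamentalRep (Fin 2) g)) σ →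
            c ≤ σ) ∧
          ((∃ σ : ℝ, Literature.MathematicalPhysics.QuantumLattice.HasStringTension μ (fun g => Literature.MathematicalPhysics.QuantumLattice.normalisedCharacter 2 (fundamentalRep (Fin 2) g)) σ) →
            Literature.MathematicalPhysics.QuantumLattice.IsConfining μ (fun g => Literature.MathematicalPhysics.QuantumLattice.normalisedCharacter 2 (fundamentalRep (Fin 2) g))) :=
  stringTension_centreBlind hd (su2_areaLawCentreBlind_star hφ)

/-- **SU(2), `d = 4`, `β_W = 23/125`**: the limit-state string-tension reading at the sharp star cell. [folklore] -/
theorem su2_stringTension_centreBlind_star_cell :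
    ∃ C c : ℝ, 0 < c ∧ ∀ 𝓦 : PerturbationFamily 4 2,
      (∀ᶠ L : ℕ in Filter.atTop, IsCentreBlind (𝓦 L)) →
        ∀ μ ∈ perturbedLimitPoints (23 / 250 : ℝ) 𝓦,
          Literature.MathematicalPhysics.QuantumLattice.HasAreaLawWith μ (fun g => Literature.MathematicalPhysics.QuantumLattice.normalisedCharacter 2 (fundamentalRep (Fin 2) g)) C c ∧
          Literature.MathematicalPhysics.QuantumLattice.HasAreaLawState μ (fun g => Literature.MathematicalPhysics.QuantumLattice.normalisedCharacter 2 (fundamentalRep (Fin 2) g)) ∧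
          (∀ σ : ℝ, Literature.MathematicalPhysics.QuantumLattice.HasStringTension μ (fun g => Literature.MathematicalPhysics.QuantumLattice.normalisedCharacter 2 (fundamentalRep (Fin 2) g)) σ →
            c ≤ σ) ∧
          ((∃ σ : ℝ, Literature.MathematicalPhysics.QuantumLattice.HasStringTension μ (fun g => Literature.MathematicalPhysics.QuantumLattice.normalisedCharacter 2 (fundamentalRep (Fin 2) g)) σ) →
            Literature.MathematicalPhysics.QuantumLattice.IsConfining μ (fun g => Literature.MathematicalPhysics.QuantumLattice.normalisedCharacter 2 (fundamentalRep (Fin 2) g))) :=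
  stringTension_centreBlind (N := 2) (by norm_num) su2_areaLawCentreBlind_star_cell_sharp

end Summit.Ventures.YMGap.RobustBall

end
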